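import Summits.QuantumFields.YangMills.Theorems.LuscherReductionTwistedTraceScalingBOStiffAssembly
import HarnessLib

/-!
# (B-ST) step (F)/(L-6), the CURRENCY ALGEBRA: `κ₀·Λ_fib ≤ X·Λ_rec`, `X = (1+η_m)(1+a)/(1−η_c) → 1`, from the quasimode floor of `btC·K₁(1,1)`, the sharp mass ratio and the matching hypothesis
# (lane A of S-BASE, crux `TwistedTraceScaling` stmt-QuantumFields-20203, C4-CORE, the (B-ST) pen; design card `Lines-BST-poincare.md` (F); HANDOFF-g21 STUB LEDGER (L-6); pattern `…BOCoreCurrency`)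

The assembly (`…BOStiffSlowAssembly.form_le_of_product_near` ∘ `…BOStiffAssembly.hST_of_pieces`) produces the core coefficient `a₁ = κ₀·Λ_fib·(1 − θ₁ + η-terms)` with the slow operator
constant `κ₀ = λ₀(L³β)/K₁(1,1)` (`…BOStiffSlowTop`) and the fibre quasimode constant `Λ_fib` of the central based kernel ((S3)); `hST` is stated in `Λ_rec = (btC/fpZ/γ)·λ₀(L³β)`.
The conversion is real arithmetic on three inputs — this file, no measure theory:
* (q) the quasimode FLOOR of the (B-T) constant `(1 − η_c)·a₀·M₂^{γ,in} ≤ btC·K₁(1,1)` (`…BODefectCoreNorm.fpBOKernel_one_one_ge_of_quasimode` + the (C1) record, as in `…BOCoreCurrency` (2));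
* (m) the SHARP mass ratio `γ = N̄·M₂^γ ≤ (1 + a)·N̄·M₂^{γ,in}` (`…BORecordGamma.recordGamma_eq` + `…BOMassRatioSharp.massRatio_le_one_add`);
* (c) the MATCHING of the two quasimode constants `Λ_fib·fpZ·N̄ ≤ (1 + η_m)·a₀` (based average vs colour-localised slow average of the same central kernel; (S3)'s output).
★★ `stiff_currency_alg` — (q)(m)(c) with `fpZ, γ, K₁ > 0`, `λ₀, Λ_fib ≥ 0` ⇒ `(λ₀/K₁)·Λ_fib ≤ ((1+η_m)(1+a)/(1−η_c))·((btC/fpZ/γ)·λ₀)`;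
★ `stiff_core_budget` — hence the `h₁` input of `…BOStiffAssembly.pieces_budget`: if moreover `(1+η_m)(1+a)/(1−η_c)·(1 − θ₁ + e) ≤ 1 − 4θ₀` then
`(λ₀/K₁)·Λ_fib·(1 − θ₁ + e) ≤ (1 − 4θ₀)·Λ_rec`.
HONEST FRAMING: real-arithmetic bookkeeping for a stub of a child of the CONDITIONAL route R2b1; (B-ST) OPEN (the matching (c) and (S3) are the lead's); C4-CORE OPEN; not a gap, not Clay.
-/

set_option autoImplicit false

noncomputable section

namespace Summit.QuantumFields.YangMills.Theorems.FemtoTransferGap.TwoLattice.ConstTube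

/-- ★★ **THE (B-ST) CURRENCY ALGEBRA** (see the module docstring). [cite: Luscher1983, §3] -/
theorem stiff_currency_alg {lam0 K₁ Λfib btC fpZ γ Nbar M2in a₀ ηc ηm a : ℝ}
    (hK₁ : 0 < K₁) (hfpZ : 0 < fpZ) (hγ : 0 < γ) (hlam : 0 ≤ lam0) (hΛfib : 0 ≤ Λfib) (hηc : ηc < 1) (hM : 0 ≤ M2in)
    (hq : (1 - ηc) * a₀ * M2in ≤ btC * K₁) (hm : γ ≤ (1 + a) * (Nbar * M2in)) (ha : 0 ≤ 1 + a) (hc : Λfib * fpZ * Nbar ≤ (1 + ηm) * a₀) (hηm : 0 ≤ 1 + ηm) :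
    lam0 / K₁ * Λfib ≤ (1 + ηm) * (1 + a) / (1 - ηc) * (btC / fpZ / γ * lam0) := by
  have h1c : 0 < 1 - ηc := by linarith
  -- `Λ_fib·fpZ·γ ≤ (1+a)·(Λ_fib fpZ N̄)·M₂in ≤ (1+a)(1+η_m)·a₀·M₂in ≤ (1+a)(1+η_m)/(1−η_c)·btC·K₁`
  have hstep1 : Λfib * fpZ * γ ≤ (1 + a) * (Λfib * fpZ * Nbar) * M2in := by
    have h := mul_le_mul_of_nonneg_left hm (mul_nonneg hΛfib hfpZ.le)
    calc Λfib * fpZ * γ ≤ Λfib * fpZ * ((1 + a) * (Nbar * M2in)) := h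
      _ = (1 + a) * (Λfib * fpZ * Nbar) * M2in := by ring
  have hstep2 : (1 + a) * (Λfib * fpZ * Nbar) * M2in ≤ (1 + a) * ((1 + ηm) * a₀) * M2in :=
    mul_le_mul_of_nonneg_right (mul_le_mul_of_nonneg_left hc ha) hM
  have hstep3 : (1 + a) * ((1 + ηm) * a₀) * M2in ≤ (1 + a) * (1 + ηm) / (1 - ηc) * (btC * K₁) := by
    have hq' : a₀ * M2in ≤ btC * K₁ / (1 - ηc) := by rw [le_div_iff₀ h1c]; linarith
    calc (1 + a) * ((1 + ηm) * a₀) * M2in = (1 + a) * (1 + ηm) * (a₀ * M2in) := by ring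
      _ ≤ (1 + a) * (1 + ηm) * (btC * K₁ / (1 - ηc)) := mul_le_mul_of_nonneg_left hq' (mul_nonneg ha hηm)
      _ = (1 + a) * (1 + ηm) / (1 - ηc) * (btC * K₁) := by ring
  have hchain : Λfib * fpZ * γ ≤ (1 + a) * (1 + ηm) / (1 - ηc) * (btC * K₁) := hstep1.trans (hstep2.trans hstep3)
  -- divide by `fpZ·γ·K₁ > 0` and multiply by `λ₀ ≥ 0`
  have hdiv : Λfib / K₁ ≤ (1 + ηm) * (1 + a) / (1 - ηc) * (btC / fpZ / γ) := by
    rw [div_le_iff₀ hK₁]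
    have : Λfib * (fpZ * γ) ≤ (1 + a) * (1 + ηm) / (1 - ηc) * btC * K₁ := by nlinarith
    rw [show (1 + ηm) * (1 + a) / (1 - ηc) * (btC / fpZ / γ) * K₁ = ((1 + a) * (1 + ηm) / (1 - ηc) * btC * K₁) / (fpZ * γ) by field_simp]
    rw [le_div_iff₀ (mul_pos hfpZ hγ)]
    exact this
  calc lam0 / K₁ * Λfib = lam0 * (Λfib / K₁) := by ring
    _ ≤ lam0 * ((1 + ηm) * (1 + a) / (1 - ηc) * (btC / fpZ / γ)) := mul_le_mul_of_nonneg_left hdiv hlam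
    _ = (1 + ηm) * (1 + a) / (1 - ηc) * (btC / fpZ / γ * lam0) := by ring

/-- ★ **The core budget `h₁` of `pieces_budget`** from the currency algebra: if in addition `X·(1 − θ₁ + e) ≤ 1 − 4θ₀` (`X = (1+η_m)(1+a)/(1−η_c)`, `1 − θ₁ + e ≥ 0`) then
`(λ₀/K₁)·Λ_fib·(1 − θ₁ + e) ≤ (1 − 4θ₀)·((btC/fpZ/γ)·λ₀)`. [folklore] -/
theorem stiff_core_budget {lam0 K₁ Λfib btC fpZ γ Nbar M2in a₀ ηc ηm a θ₁ θ₀ e : ℝ}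
    (hK₁ : 0 < K₁) (hfpZ : 0 < fpZ) (hγ : 0 < γ) (hlam : 0 ≤ lam0) (hΛfib : 0 ≤ Λfib) (hηc : ηc < 1) (hM : 0 ≤ M2in)
    (hq : (1 - ηc) * a₀ * M2in ≤ btC * K₁) (hm : γ ≤ (1 + a) * (Nbar * M2in)) (ha : 0 ≤ 1 + a) (hc : Λfib * fpZ * Nbar ≤ (1 + ηm) * a₀) (hηm : 0 ≤ 1 + ηm)
    (hbtC : 0 ≤ btC) (he : 0 ≤ 1 - θ₁ + e) (hX : (1 + ηm) * (1 + a) / (1 - ηc) * (1 - θ₁ + e) ≤ 1 - 4 * θ₀) :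
    lam0 / K₁ * Λfib * (1 - θ₁ + e) ≤ (1 - 4 * θ₀) * (btC / fpZ / γ * lam0) := by
  have h := stiff_currency_alg hK₁ hfpZ hγ hlam hΛfib hηc hM hq hm ha hc hηm
  have hΛrec : 0 ≤ btC / fpZ / γ * lam0 := by positivity
  calc lam0 / K₁ * Λfib * (1 - θ₁ + e) ≤ (1 + ηm) * (1 + a) / (1 - ηc) * (btC / fpZ / γ * lam0) * (1 - θ₁ + e) := mul_le_mul_of_nonneg_right h he
    _ = (1 + ηm) * (1 + a) / (1 - ηc) * (1 - θ₁ + e) * (btC / fpZ / γ * lam0) := by ring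
    _ ≤ (1 - 4 * θ₀) * (btC / fpZ / γ * lam0) := mul_le_mul_of_nonneg_right hX hΛrec

end Summit.QuantumFields.YangMills.Theorems.FemtoTransferGap.TwoLattice.ConstTube

end
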